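import Mathlib.Analysis.InnerProductSpace.Calculus
import Mathlib.Analysis.SpecialFunctions.Log.Deriv
import Literature.Analysis.FluidPDE.VanishingVerticalVorticityPotentials
import Literature.Analysis.FunctionSpaces.SmoothParametricIntegral
import HarnessLib

/-!
# Potentials for fields with vanishing vertical vorticity, II: time-dependent fields

Analysis/FluidPDE support file (theorems only; no definitions, no named facts), companion of
`VanishingVerticalVorticityPotentials.lean` (horizontal line potential `φ`, stream function
`ψ = V₂ − ∂₂φ`, `V = ∇φ + ψ e₂`, `curl V = ∇ψ × e₂`). Serves the STAGED door route
`PoloidalWindowDoor` of `NavierStokesRegularity` (crux K2 `PoloidalWindowRigidity`, open stub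
`stub_nonflatLiouville`), whose profiles are time-dependent fields `v : (−∞,0) × ℝ³ → ℝ³` jointly
smooth on the open slab: the evolution equations for `(φ, ψ)` need the potentials to be jointly smooth
in `(t, x)`.

* `VerticalVorticityFree.contDiffOn_linePotential_uncurry` — if `uncurry v` is `C^∞` on
  `(−∞,0) × ℝ³` then `(t, x) ↦ ∫₀¹ ⟪v t (σ x_h + x₂ e₂), x_h⟫ dσ` is `C^∞` there. Proof: the slab is
  not all of `ℝ × ℝ³`, so we reparametrise `t = −e^τ` (the field `(τ, y) ↦ v(−e^τ, y)` is globally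
  smooth), differentiate under the integral sign in the parameters `(τ, x)`
  (`Literature.Analysis.FunctionSpaces.contDiff_parametric_intervalIntegral`), and return with
  `τ = log(−t)`, smooth on the slab.

## Mathlib / tree search

As in part I; `Real.contDiffOn_log`, `Real.contDiff_exp` (Mathlib); no parameter-dependent Poincaré
lemma in Mathlib or the tree (2026-08-26).

## References

* M. Spivak, *Calculus on Manifolds* (1965), Thm. 4-11 (Poincaré lemma; the homotopy operator `I`
  depends smoothly on parameters, being an integral of a smooth integrand over `[0,1]`).
* L. Hörmander, *The Analysis of Linear Partial Differential Operators I*, Thm. 1.1.9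
  (differentiation under the integral sign).
-/

noncomputable section

namespace Literature.Analysis.FluidPDE.VerticalVorticityFree

open Set Function MeasureTheory intervalIntegral InnerProductSpace
open scoped InnerProductSpace RealInnerProductSpace ContDiff

/-- **Time-dependent fields: joint smoothness of the horizontal line potential.** If `v : ℝ → ℝ³ → ℝ³`
is jointly smooth on the open slab `(−∞,0) × ℝ³`, then so is the family of horizontal line potentials
`(t, x) ↦ ∫₀¹ ⟪v t (σ x_h + x₂ e₂), x_h⟫ dσ` (reparametrise `t = −e^τ` to a globally smooth field, differentiate
under the integral sign, and return with `τ = log(−t)`). [cite: Spivak1965, Thm 4-11 (the operator I, smooth dependence on parameters)] -/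
theorem contDiffOn_linePotential_uncurry
    {v : ℝ → EuclideanSpace ℝ (Fin 3) → EuclideanSpace ℝ (Fin 3)}
    (hv : ContDiffOn ℝ ∞ (uncurry v) (Iio (0 : ℝ) ×ˢ univ)) :
    ContDiffOn ℝ ∞ (uncurry fun (t : ℝ) (x : EuclideanSpace ℝ (Fin 3)) =>
      ∫ σ in (0 : ℝ)..1, ⟪v t (σ • (x - x 2 • (EuclideanSpace.single (2 : Fin 3) (1 : ℝ))) +
        x 2 • (EuclideanSpace.single (2 : Fin 3) (1 : ℝ))),
        x - x 2 • (EuclideanSpace.single (2 : Fin 3) (1 : ℝ))⟫_ℝ) (Iio (0 : ℝ) ×ˢ univ) := by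
  -- the globally smooth reparametrised field `w (τ, y) = v (−e^τ) y`
  have hg : ContDiff ℝ ∞ fun q : ℝ × EuclideanSpace ℝ (Fin 3) => ((-Real.exp q.1, q.2) : ℝ × EuclideanSpace ℝ (Fin 3)) :=
    (Real.contDiff_exp.comp contDiff_fst).neg.prodMk contDiff_snd
  have hgmem : ∀ q : ℝ × EuclideanSpace ℝ (Fin 3), ((-Real.exp q.1, q.2) : ℝ × EuclideanSpace ℝ (Fin 3)) ∈ Iio (0 : ℝ) ×ˢ (univ : Set (EuclideanSpace ℝ (Fin 3))) :=
    fun q => mk_mem_prod (by simpa using Real.exp_pos q.1) (mem_univ _)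
  have hw : ContDiff ℝ ∞ fun q : ℝ × EuclideanSpace ℝ (Fin 3) => v (-Real.exp q.1) q.2 :=
    hv.comp_contDiff hg hgmem
  -- the integrand in the variables `(σ, (τ, x))`
  have h2 : ContDiff ℝ ∞ fun p : ℝ × (ℝ × EuclideanSpace ℝ (Fin 3)) => p.2.2 2 :=
    (EuclideanSpace.proj (2 : Fin 3) : EuclideanSpace ℝ (Fin 3) →L[ℝ] ℝ).contDiff.comp (contDiff_snd.comp contDiff_snd)
  have hB : ContDiff ℝ ∞ fun p : ℝ × (ℝ × EuclideanSpace ℝ (Fin 3)) =>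
      p.2.2 - p.2.2 2 • (EuclideanSpace.single (2 : Fin 3) (1 : ℝ)) :=
    (contDiff_snd.comp contDiff_snd).sub (h2.smul contDiff_const)
  have hA : ContDiff ℝ ∞ fun p : ℝ × (ℝ × EuclideanSpace ℝ (Fin 3)) =>
      p.1 • (p.2.2 - p.2.2 2 • (EuclideanSpace.single (2 : Fin 3) (1 : ℝ))) +
        p.2.2 2 • (EuclideanSpace.single (2 : Fin 3) (1 : ℝ)) :=
    (contDiff_fst.smul hB).add (h2.smul contDiff_const)
  have hH : ContDiff ℝ ∞ fun p : ℝ × (ℝ × EuclideanSpace ℝ (Fin 3)) =>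
      ⟪v (-Real.exp p.2.1) (p.1 • (p.2.2 - p.2.2 2 • (EuclideanSpace.single (2 : Fin 3) (1 : ℝ))) +
        p.2.2 2 • (EuclideanSpace.single (2 : Fin 3) (1 : ℝ))),
        p.2.2 - p.2.2 2 • (EuclideanSpace.single (2 : Fin 3) (1 : ℝ))⟫_ℝ := by
    have hcomp : ContDiff ℝ ∞ fun p : ℝ × (ℝ × EuclideanSpace ℝ (Fin 3)) =>
        v (-Real.exp p.2.1) (p.1 • (p.2.2 - p.2.2 2 • (EuclideanSpace.single (2 : Fin 3) (1 : ℝ))) +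
          p.2.2 2 • (EuclideanSpace.single (2 : Fin 3) (1 : ℝ))) :=
      hw.comp ((contDiff_fst.comp contDiff_snd).prodMk hA)
    exact hcomp.inner ℝ hB
  have hΦw : ContDiff ℝ ∞ fun q : ℝ × EuclideanSpace ℝ (Fin 3) =>
      ∫ σ in (0 : ℝ)..1, ⟪v (-Real.exp q.1) (σ • (q.2 - q.2 2 • (EuclideanSpace.single (2 : Fin 3) (1 : ℝ))) +
        q.2 2 • (EuclideanSpace.single (2 : Fin 3) (1 : ℝ))),
        q.2 - q.2 2 • (EuclideanSpace.single (2 : Fin 3) (1 : ℝ))⟫_ℝ :=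
    Literature.Analysis.FunctionSpaces.contDiff_parametric_intervalIntegral hH 0 1
  -- return with `τ = log(−t)` on the slab
  have hlog : ContDiffOn ℝ ∞ (fun q : ℝ × EuclideanSpace ℝ (Fin 3) => ((Real.log (-q.1), q.2) : ℝ × EuclideanSpace ℝ (Fin 3)))
      (Iio (0 : ℝ) ×ˢ univ) := by
    refine ContDiffOn.prodMk ?_ contDiff_snd.contDiffOn
    have h1 : ContDiffOn ℝ ∞ (fun q : ℝ × EuclideanSpace ℝ (Fin 3) => -q.1) (Iio (0 : ℝ) ×ˢ univ) :=
      contDiff_fst.neg.contDiffOn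
    refine (Real.contDiffOn_log.comp h1 ?_)
    rintro ⟨t, x⟩ ⟨ht, -⟩
    simp only [mem_compl_iff, mem_singleton_iff, neg_eq_zero]
    exact (ne_of_lt ht)
  refine (hΦw.comp_contDiffOn hlog).congr ?_
  rintro ⟨t, x⟩ ⟨ht, -⟩
  have ht' : (0 : ℝ) < -t := neg_pos.2 ht
  simp only [uncurry_apply_pair, comp_apply, Real.exp_log ht', neg_neg]

end Literature.Analysis.FluidPDE.VerticalVorticityFree

end
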